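import Mathlib.Analysis.SpecialFunctions.Integrals.Basic
import Mathlib.MeasureTheory.Integral.IntervalIntegral.Periodic
import Literature.Analysis.FluidPDE.VortexFilament.TestField

/-!
# Self-energy of the filament: lower bound for the line integral of the test field

Support file for the proof of the Jerrard–Seis energy lower bound
(`Literature.Analysis.FluidPDE.VortexFilament.JerrardSeis2016_filamentEnergyLowerBound`).
For the test field `ξ = F ∗ μ_Γ` of `TestField.lean` with a kernel `F ≥ 0` which is radially
non-increasing, `= 1/|z|` on `ε ≤ |z| ≤ L/2` and `≤ √2/max(ε,|z|)`, this file proves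
`∫ ξ · dμ_Γ ≥ 2 L log(L/ε) − 49 K L` (`tangentLineIntegral_ge`), `K` the weak-`L¹` bound of
`κ*`.

## Proof

`⟪ξ(γ(t)), γ'(t)⟫ = ∫ F(γ(t) − γ(s)) ⟪γ'(s), γ'(t)⟫ ds` (`inner_testField_eq`). At a unit-speed
parameter `t` with admissible radius `ρ` (security radius, [JerrardSeis2016, §2.1 (1)]), the
integrand is `≥ φ(|s − t|_L) − √2 max(ρ/2, |γ(s) − γ(t)|)^{-1}` a.e. with
`φ(d) = 1/d − d/(2ρ²)` on `[ε, ρ]` (`selfEnergy_integrand_ge`: chord `≤` arc and the two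
security conditions); `∫ φ(|s − t|_L) ds = ∫_{−L/2}^{L/2} φ(|h|) dh ≥ 2 log(ρ/ε) − ½`
(`integral_nearProfile_ge`) and `∫ max(ρ/2, |γ(s) − γ(t)|)^{-1} ds ≤ 2√(48KL/ρ)` by Lemma 4 and a
layer cake (`IsArclengthLoop.integral_inv_dist_le`), whence
`⟪ξ(γ t), γ'(t)⟫ ≥ 2 log(ρ/ε) − ½ − 2√(96KL/ρ)` (`inner_testField_ge`). Since the security radius
need not be measurable, the integration in `t` compares level sets:
`{⟪ξ(γ t), γ'(t)⟫ < α − λ} ⊆ {κ* ≥ λ²/(576KL)}` (`α = 2 log(L/ε) − ½`), and the layer cake with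
a `min(L, c/λ²)` tail gives `∫ (α − ⟪ξ(γ t), γ'(t)⟫)⁺ ≤ 48 K L`. This is the analogue of the
self-energy asymptotics `‖v^ε‖² = |log ε|/(2π) + O(‖κ*‖²)` of [JerrardSeis2016, Prop. 1 (ve.2)].

No definitions are introduced.
-/

noncomputable section

open MeasureTheory Set Filter Function Metric intervalIntegral
open scoped Topology InnerProductSpace RealInnerProductSpace ENNReal NNReal

namespace Literature.Analysis.FluidPDE

namespace VortexFilament

/-! ### The near-field profile and its integral over a period -/

/-- The explicit one-variable integral of the near-field lower profile:
`∫_ε^ρ (1/h − h/(2ρ²)) dh ≥ log(ρ/ε) − 1/4` for `0 < ε ≤ ρ`. [folklore] -/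
theorem integral_inv_sub_ge {ε ρ : ℝ} (hε : 0 < ε) (hερ : ε ≤ ρ) :
    Real.log (ρ / ε) - 1 / 4 ≤ ∫ h in ε..ρ, (h⁻¹ - h / (2 * ρ ^ 2)) := by
  have hρ : 0 < ρ := hε.trans_le hερ
  rw [intervalIntegral.integral_sub, integral_inv_of_pos hε hρ]
  · have : ∫ h in ε..ρ, h / (2 * ρ ^ 2) = (ρ ^ 2 - ε ^ 2) / 2 / (2 * ρ ^ 2) := by
      simp_rw [div_eq_mul_inv]
      rw [intervalIntegral.integral_mul_const, integral_id]
      ring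
    rw [this]
    have h1 : (ρ ^ 2 - ε ^ 2) / 2 / (2 * ρ ^ 2) ≤ 1 / 4 := by
      rw [div_div, div_le_div_iff₀ (by positivity) (by positivity)]
      nlinarith
    linarith
  · exact intervalIntegral.intervalIntegrable_inv (fun h hh => by
      have : ε ≤ h := by
        rw [uIcc_of_le hερ] at hh; exact hh.1
      exact (hε.trans_le this).ne') continuousOn_id
  · exact (continuous_id.div_const _).intervalIntegrable _ _

/-- **The near-field integral over a period.** For `0 < ε`, `0 < ρ ≤ L/2`, with
`φ(d) = 1/d − d/(2ρ²)` on `[ε, ρ]` and `0` elsewhere,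
`∫_{−L/2}^{L/2} φ(|h|) dh ≥ 2 log(ρ/ε) − 1/2`. [folklore] -/
theorem integral_nearProfile_ge {ε ρ L : ℝ} (hε : 0 < ε) (hρ : 0 < ρ) (hρL : ρ ≤ L / 2) :
    2 * Real.log (ρ / ε) - 1 / 2 ≤
      ∫ h in (-(L / 2))..(L / 2),
        (if ε ≤ |h| ∧ |h| ≤ ρ then |h|⁻¹ - |h| / (2 * ρ ^ 2) else 0) := by
  set φ : ℝ → ℝ := fun h => if ε ≤ |h| ∧ |h| ≤ ρ then |h|⁻¹ - |h| / (2 * ρ ^ 2) else 0 with hφ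
  -- basic properties of `φ`
  have hφ_nonneg : ∀ h, 0 ≤ φ h := by
    intro h
    simp only [hφ]
    split_ifs with hh
    · obtain ⟨h1, h2⟩ := hh
      have hpos : 0 < |h| := hε.trans_le h1
      rw [sub_nonneg, div_le_iff₀ (by positivity), inv_mul_eq_div, le_div_iff₀ hpos]
      nlinarith
    · exact le_rfl
  have hφ_bdd : ∀ h, φ h ≤ ε⁻¹ := by
    intro h
    simp only [hφ]
    split_ifs with hh
    · obtain ⟨h1, h2⟩ := hh
      have hpos : 0 < |h| := hε.trans_le h1
      calc |h|⁻¹ - |h| / (2 * ρ ^ 2) ≤ |h|⁻¹ := by linarith [div_nonneg hpos.le (by positivity : (0:ℝ) ≤ 2 * ρ ^ 2)]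
        _ ≤ ε⁻¹ := inv_anti₀ hε h1
    · positivity
  have hφ_meas : Measurable φ := by
    simp only [hφ]
    refine Measurable.ite ?_ ((continuous_abs.measurable.inv).sub
      (continuous_abs.measurable.div_const _)) measurable_const
    exact (measurableSet_le measurable_const continuous_abs.measurable).inter
      (measurableSet_le continuous_abs.measurable measurable_const)
  have hφ_int : ∀ a b : ℝ, IntervalIntegrable φ volume a b := by
    intro a b
    refine (intervalIntegrable_const (c := ε⁻¹)).mono_fun' hφ_meas.aestronglyMeasurable ?_
    exact ae_of_all _ fun h => by
      show ‖φ h‖ ≤ ε⁻¹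
      rw [Real.norm_eq_abs, abs_of_nonneg (hφ_nonneg h)]; exact hφ_bdd h
  have hφ_even : ∀ h, φ (-h) = φ h := by intro h; simp only [hφ, abs_neg]
  -- if `ρ < ε` the profile vanishes and the claim is trivial
  rcases lt_or_ge ρ ε with hρε | hερ
  · have h1 : Real.log (ρ / ε) < 0 := Real.log_neg (by positivity) ((div_lt_one hε).2 hρε)
    have h2 : 0 ≤ ∫ h in (-(L / 2))..(L / 2), φ h :=
      intervalIntegral.integral_nonneg (by linarith) fun h _ => hφ_nonneg h
    show 2 * Real.log (ρ / ε) - 1 / 2 ≤ ∫ h in (-(L / 2))..(L / 2), φ h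
    linarith
  -- split the period into five pieces and drop three nonnegative ones
  have hsplit : ∫ h in (-(L / 2))..(L / 2), φ h =
      (∫ h in (-(L / 2))..(-ρ), φ h) + (∫ h in (-ρ)..(-ε), φ h) + (∫ h in (-ε)..ε, φ h) +
        (∫ h in ε..ρ, φ h) + ∫ h in ρ..(L / 2), φ h := by
    rw [integral_add_adjacent_intervals (hφ_int _ _) (hφ_int _ _),
      integral_add_adjacent_intervals (hφ_int _ _) (hφ_int _ _),
      integral_add_adjacent_intervals (hφ_int _ _) (hφ_int _ _),
      integral_add_adjacent_intervals (hφ_int _ _) (hφ_int _ _)]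
  have hnn : ∀ a b : ℝ, a ≤ b → 0 ≤ ∫ h in a..b, φ h := fun a b hab =>
    intervalIntegral.integral_nonneg hab fun h _ => hφ_nonneg h
  -- the two symmetric main pieces
  have hmain : ∫ h in ε..ρ, φ h = ∫ h in ε..ρ, (h⁻¹ - h / (2 * ρ ^ 2)) := by
    refine integral_congr fun h hh => ?_
    rw [uIcc_of_le hερ] at hh
    have hpos : 0 < h := hε.trans_le hh.1
    simp only [hφ, abs_of_pos hpos, hh.1, hh.2, and_self, if_true]
  have hsymm : ∫ h in (-ρ)..(-ε), φ h = ∫ h in ε..ρ, φ h := by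
    rw [← intervalIntegral.integral_comp_neg]
    simp only [hφ_even]
  have hval := integral_inv_sub_ge hε hερ
  show 2 * Real.log (ρ / ε) - 1 / 2 ≤ ∫ h in (-(L / 2))..(L / 2), φ h
  rw [hsplit, hsymm, hmain]
  have h1 := hnn (-(L / 2)) (-ρ) (by linarith)
  have h2 := hnn (-ε) ε (by linarith)
  have h3 := hnn ρ (L / 2) hρL
  linarith

/-! ### The line integral of the test field along the curve -/

section SelfEnergy

variable {L : ℝ} {γ : ℝ → EuclideanSpace ℝ (Fin 3)}

/-- The near-field integral over a period equals the symmetric integral of the profile: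
`∫_{[0,L)} φ(|s − t|_L) ds = ∫_{−L/2}^{L/2} φ(|h|) dh` for any `φ`. [folklore] -/
theorem integral_comp_loopDist_eq {L : ℝ} (hL : 0 < L) (φ : ℝ → ℝ) (t : ℝ) :
    ∫ s in Ico 0 L, φ (loopDist L (s - t)) = ∫ h in (-(L / 2))..(L / 2), φ |h| := by
  have hper : Function.Periodic (fun s => φ (loopDist L (s - t))) L := by
    intro s; simp only [add_sub_right_comm, loopDist_add_period]
  rw [integral_Ico_eq_integral_Ioc, ← intervalIntegral.integral_of_le hL.le]
  have h1 := hper.intervalIntegral_add_eq 0 (t - L / 2)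
  rw [zero_add] at h1
  rw [h1]
  have h2 : (fun s => φ (loopDist L (s - t))) = fun s => (fun h => φ (loopDist L h)) (s - t) := rfl
  rw [h2, intervalIntegral.integral_comp_sub_right (fun h => φ (loopDist L h)) t]
  have h3 : t - L / 2 - t = -(L / 2) := by ring
  have h4 : t - L / 2 + L - t = L / 2 := by ring
  rw [h3, h4]
  refine intervalIntegral.integral_congr fun h hh => ?_
  rw [uIcc_of_le (by linarith)] at hh
  show φ (loopDist L h) = φ |h|
  rw [loopDist_eq_abs hL (abs_le.2 ⟨by linarith [hh.1], hh.2⟩)]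

/-- **The line integral of the test field in terms of the kernel**:
`⟪ξ(γ(t)), γ'(t)⟫ = ∫ F(γ(t) − γ(s)) ⟪γ'(s), γ'(t)⟫ ds`. [folklore] -/
theorem inner_testField_eq (hγ : IsArclengthLoop L γ) {F : EuclideanSpace ℝ (Fin 3) → ℝ}
    (hFc : Continuous F) (hFs : HasCompactSupport F)
    {ξ : EuclideanSpace ℝ (Fin 3) → EuclideanSpace ℝ (Fin 3)}
    (hξ : ξ = fun x => ∫ s in Ico 0 L, F (x - γ s) • deriv γ s) (t : ℝ) :
    ⟪ξ (γ t), deriv γ t⟫ = ∫ s in Ico 0 L, F (γ t - γ s) * ⟪deriv γ s, deriv γ t⟫ := by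
  rw [hξ, real_inner_comm]
  simp only
  rw [← integral_inner (integrable_testField_integrand hγ hFc hFs (γ t))]
  congr 1; funext s
  rw [real_inner_smul_right, real_inner_comm]

/-- **Layer cake (b).** `∫_{[0,L)} max(ρ/2, |γ(s) − x|)^{-1} ds ≤ 2 √(48 K L/ρ)`: the level
sets have measure `≤ min(L, 24K/τ) ≤ √(24KL) τ^{-1/2}` by Lemma 4. [cite: JerrardSeis2016, §4.1 Lemma 4 (consequence)] -/
theorem IsArclengthLoop.integral_inv_dist_le (hγ : IsArclengthLoop L γ) {K : ℝ≥0}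
    (hK : weakL1Norm L (kappaStar L γ) ≤ K) {ρ : ℝ} (hρ : 0 < ρ) (x : EuclideanSpace ℝ (Fin 3)) :
    ∫ s in Ico 0 L, (max (ρ / 2) ‖γ s - x‖)⁻¹ ≤ 2 * Real.sqrt (48 * K * L / ρ) := by
  have hL := hγ.pos
  have hK0 : (0:ℝ) ≤ K := K.2
  have hm0 : ∀ s, 0 < max (ρ / 2) ‖γ s - x‖ := fun s => lt_max_of_lt_left (by positivity)
  have hmeas : Measurable fun s => (max (ρ / 2) ‖γ s - x‖)⁻¹ :=
    ((continuous_const.max (hγ.lipschitz.continuous.sub continuous_const).norm).inv₀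
      (fun s => (hm0 s).ne')).measurable
  have h := integral_le_of_meas_lt_le_rpow_neg_half (μ := volume.restrict (Ico (0:ℝ) L))
    (G := fun s => (max (ρ / 2) ‖γ s - x‖)⁻¹) (T := (ρ / 2)⁻¹) (c := Real.sqrt (24 * K * L))
    (Real.sqrt_nonneg _) (by positivity) (fun s => (inv_pos.2 (hm0 s)).le)
    (fun s => inv_anti₀ (by positivity) (le_max_left _ _)) hmeas.aemeasurable ?_
  · refine h.trans (le_of_eq ?_)
    rw [mul_assoc, ← Real.sqrt_mul (by positivity)]
    congr 2
    field_simp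
    ring
  · intro τ hτ _
    rw [Measure.restrict_apply' measurableSet_Ico]
    have hsub : {s | τ < (max (ρ / 2) ‖γ s - x‖)⁻¹} ∩ Ico 0 L ⊆
        {s : ℝ | s ∈ Ico 0 L ∧ ‖γ s - x‖ < τ⁻¹} := by
      intro s hs
      refine ⟨hs.2, ?_⟩
      have h1 : τ < (max (ρ / 2) ‖γ s - x‖)⁻¹ := hs.1
      rw [lt_inv_comm₀ hτ (hm0 s)] at h1
      exact lt_of_le_of_lt (le_max_right _ _) h1
    have hb1 : volume ({s | τ < (max (ρ / 2) ‖γ s - x‖)⁻¹} ∩ Ico 0 L) ≤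
        ENNReal.ofReal (24 * τ⁻¹ * K) :=
      (measure_mono hsub).trans (hγ.volume_near_le hK x (inv_pos.2 hτ))
    have hb2 : volume ({s | τ < (max (ρ / 2) ‖γ s - x‖)⁻¹} ∩ Ico 0 L) ≤ ENNReal.ofReal L := by
      calc volume ({s | τ < (max (ρ / 2) ‖γ s - x‖)⁻¹} ∩ Ico 0 L) ≤ volume (Ico (0:ℝ) L) :=
            measure_mono inter_subset_right
        _ = ENNReal.ofReal L := by rw [Real.volume_Ico, sub_zero]
    have hmin : volume ({s | τ < (max (ρ / 2) ‖γ s - x‖)⁻¹} ∩ Ico 0 L) ≤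
        ENNReal.ofReal (min L (24 * τ⁻¹ * K)) := by
      rcases le_total L (24 * τ⁻¹ * K) with h | h
      · rw [min_eq_left h]; exact hb2
      · rw [min_eq_right h]; exact hb1
    refine hmin.trans (ENNReal.ofReal_le_ofReal ?_)
    have hms : ∀ {a b : ℝ}, 0 ≤ a → 0 ≤ b → min a b ≤ Real.sqrt (a * b) := by
      intro a b ha hb
      rw [Real.le_sqrt (le_min ha hb) (mul_nonneg ha hb)]
      rcases le_total a b with h | h
      · rw [min_eq_left h]; nlinarith
      · rw [min_eq_right h]; nlinarith
    calc min L (24 * τ⁻¹ * K) ≤ Real.sqrt (L * (24 * τ⁻¹ * K)) := hms hL.le (by positivity)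
      _ = Real.sqrt (24 * K * L) * τ ^ (-(1/2 : ℝ)) := by
          rw [Real.rpow_neg hτ.le, ← Real.sqrt_eq_rpow, ← Real.sqrt_inv, ← Real.sqrt_mul (by positivity)]
          congr 1; ring

/-- **Pointwise lower bound for the self-energy integrand.** At a unit-speed parameter `t` with
admissible radius `ρ`, for a.e. `s`:
`F(γ(t) − γ(s)) ⟪γ'(s), γ'(t)⟫ ≥ φ(|s − t|_L) − √2 max(ρ/2, |γ(s) − γ(t)|)^{-1}`, where
`φ(d) = 1/d − d/(2ρ²)` on `[ε, ρ]` and `0` elsewhere: on the near arc the chord is at most the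
arc (`F ≥ 1/d` by radial monotonicity) and `⟪γ'(s), γ'(t)⟫ ≥ 1 − d²/(2ρ²)` (second security
condition); on the far arc `|γ(s) − γ(t)| ≥ ρ/2` (first condition) and `F ≤ √2/max(ε,|z|)`.
[cite: JerrardSeis2016, §4.1 (security radius), §4.5 (near/far-field splitting, analogue)] -/
theorem selfEnergy_integrand_ge (hγ : IsArclengthLoop L γ) {ε : ℝ} (hε : 0 < ε)
    {F : EuclideanSpace ℝ (Fin 3) → ℝ} (hF0 : ∀ z, 0 ≤ F z)
    (hFle : ∀ z : EuclideanSpace ℝ (Fin 3), F z ≤ Real.sqrt 2 * (max ε ‖z‖)⁻¹)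
    (hFann : ∀ z : EuclideanSpace ℝ (Fin 3), ε ≤ ‖z‖ → ‖z‖ ≤ L / 2 → F z = ‖z‖⁻¹)
    (hFanti : ∀ z w : EuclideanSpace ℝ (Fin 3), ‖z‖ ≤ ‖w‖ → F w ≤ F z)
    {t ρ : ℝ} (ht : ‖deriv γ t‖ = 1) (hρ : ρ ∈ securityRadii L γ t) :
    ∀ᵐ s : ℝ, (if ε ≤ loopDist L (s - t) ∧ loopDist L (s - t) ≤ ρ then
        (loopDist L (s - t))⁻¹ - loopDist L (s - t) / (2 * ρ ^ 2) else 0) -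
        Real.sqrt 2 * (max (ρ / 2) ‖γ s - γ t‖)⁻¹ ≤
      F (γ t - γ s) * ⟪deriv γ s, deriv γ t⟫ := by
  have hL := hγ.pos
  have hρ0 : 0 < ρ := hρ.1
  have hρL : ρ ≤ L / 2 := hγ.le_half_of_mem_securityRadii ht hρ
  have hunit := hγ.norm_deriv_ae
  filter_upwards [hunit] with s hs
  set h : ℝ := s - t with hh
  set d : ℝ := loopDist L h with hd
  have hst : s = t + h := by rw [hh]; ring
  have hd0 : 0 ≤ d := loopDist_nonneg _ _
  have hG0 : 0 ≤ Real.sqrt 2 * (max (ρ / 2) ‖γ s - γ t‖)⁻¹ :=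
    mul_nonneg (Real.sqrt_nonneg _) (inv_nonneg.2 (le_max_of_le_left (by positivity)))
  -- chord ≤ arc
  have hchord : ‖γ t - γ s‖ ≤ d := by
    set k : ℤ := round (L⁻¹ * h) with hk
    have hrep : |h - k * L| = d := by rw [hd, loopDist_eq]
    have hγs : γ (t + (h - k * L)) = γ s := by
      rw [hst, show t + (h - k * L) = t + h - k * L by ring]
      exact hγ.periodic.sub_int_mul_eq k
    rw [← hγs, norm_sub_rev]
    calc ‖γ (t + (h - k * L)) - γ t‖ ≤ 1 * ‖(t + (h - k * L)) - t‖ := by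
          have := hγ.lipschitz.dist_le_mul (t + (h - k * L)) t
          simpa [dist_eq_norm] using this
      _ = d := by rw [one_mul, add_sub_cancel_left, Real.norm_eq_abs, hrep]
  rcases le_or_gt d ρ with hnear | hfar
  · -- near arc: the integrand is at least `φ(d)`
    have hinner : 1 - (d / ρ) ^ 2 / 2 ≤ ⟪deriv γ s, deriv γ t⟫ := by
      have := inner_deriv_ge_of_mem_securityRadii hρ (hd ▸ hnear) ht (by rw [← hst]; exact hs)
      rwa [← hst] at this
    have hinner0 : 0 ≤ ⟪deriv γ s, deriv γ t⟫ := by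
      have : (d / ρ) ^ 2 ≤ 1 := by
        rw [div_pow, div_le_one (by positivity)]
        exact pow_le_pow_left₀ hd0 hnear 2
      linarith
    suffices hφ : (if ε ≤ d ∧ d ≤ ρ then d⁻¹ - d / (2 * ρ ^ 2) else 0) ≤
        F (γ t - γ s) * ⟪deriv γ s, deriv γ t⟫ by linarith
    split_ifs with hcond
    · obtain ⟨hεd, -⟩ := hcond
      have hdpos : 0 < d := hε.trans_le hεd
      -- `F(γ t − γ s) ≥ 1/d`
      set w : EuclideanSpace ℝ (Fin 3) := d • EuclideanSpace.single 0 (1:ℝ) with hw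
      have hwn : ‖w‖ = d := by
        rw [hw, norm_smul, Real.norm_eq_abs, abs_of_pos hdpos]; simp
      have hFw : F w = d⁻¹ := by rw [hFann w (hwn ▸ hεd) (hwn ▸ hnear.trans hρL), hwn]
      have hF1 : d⁻¹ ≤ F (γ t - γ s) := by
        rw [← hFw]; exact hFanti _ _ (hchord.trans_eq hwn.symm)
      have hφeq : d⁻¹ - d / (2 * ρ ^ 2) = d⁻¹ * (1 - (d / ρ) ^ 2 / 2) := by
        field_simp
      rw [hφeq]
      exact mul_le_mul hF1 hinner (by
        have : (d / ρ) ^ 2 ≤ 1 := by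
          rw [div_pow, div_le_one (by positivity)]; exact pow_le_pow_left₀ hd0 hnear 2
        linarith) (hF0 _)
    · exact mul_nonneg (hF0 _) hinner0
  · -- far arc: the integrand is at least `−√2 / max(ρ/2, |γ s − γ t|)`
    have hfar' : ρ / 2 ≤ ‖γ s - γ t‖ := by
      have := hρ.2.1 h (hd ▸ hfar.le)
      rwa [← hst] at this
    have hcond : ¬ (ε ≤ d ∧ d ≤ ρ) := fun hc => (not_le.2 hfar) hc.2
    rw [if_neg hcond, zero_sub]
    have habs : |F (γ t - γ s) * ⟪deriv γ s, deriv γ t⟫| ≤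
        Real.sqrt 2 * (max (ρ / 2) ‖γ s - γ t‖)⁻¹ := by
      rw [abs_mul, abs_of_nonneg (hF0 _)]
      have h1 : |⟪deriv γ s, deriv γ t⟫| ≤ 1 := by
        calc |⟪deriv γ s, deriv γ t⟫| ≤ ‖deriv γ s‖ * ‖deriv γ t‖ := abs_real_inner_le_norm _ _
          _ ≤ 1 * 1 := mul_le_mul (hγ.norm_deriv_le_one s) (hγ.norm_deriv_le_one t)
              (norm_nonneg _) zero_le_one
          _ = 1 := mul_one _
      have h2 : F (γ t - γ s) ≤ Real.sqrt 2 * (max (ρ / 2) ‖γ s - γ t‖)⁻¹ := by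
        refine (hFle _).trans ?_
        rw [norm_sub_rev]
        refine mul_le_mul_of_nonneg_left (inv_anti₀ (lt_max_of_lt_left (by positivity)) ?_)
          (Real.sqrt_nonneg _)
        rw [max_eq_right hfar']; exact le_max_right _ _
      calc F (γ t - γ s) * |⟪deriv γ s, deriv γ t⟫| ≤ Real.sqrt 2 * (max (ρ / 2) ‖γ s - γ t‖)⁻¹ * 1 :=
            mul_le_mul h2 h1 (abs_nonneg _) hG0
        _ = _ := mul_one _
    linarith [neg_abs_le (F (γ t - γ s) * ⟪deriv γ s, deriv γ t⟫)]

/-- **Per-parameter lower bound.** At a unit-speed parameter `t` with admissible radius `ρ`,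
`⟪ξ(γ(t)), γ'(t)⟫ ≥ 2 log(ρ/ε) − 1/2 − 2√(96 K L/ρ)`. [cite: JerrardSeis2016, Prop 1 (ve.2) (analogue: self-energy of the filament)] -/
theorem inner_testField_ge (hγ : IsArclengthLoop L γ) {K : ℝ≥0}
    (hK : weakL1Norm L (kappaStar L γ) ≤ K) {ε : ℝ} (hε : 0 < ε)
    {F : EuclideanSpace ℝ (Fin 3) → ℝ} (hFc : Continuous F) (hFs : HasCompactSupport F)
    (hF0 : ∀ z, 0 ≤ F z)
    (hFle : ∀ z : EuclideanSpace ℝ (Fin 3), F z ≤ Real.sqrt 2 * (max ε ‖z‖)⁻¹)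
    (hFann : ∀ z : EuclideanSpace ℝ (Fin 3), ε ≤ ‖z‖ → ‖z‖ ≤ L / 2 → F z = ‖z‖⁻¹)
    (hFanti : ∀ z w : EuclideanSpace ℝ (Fin 3), ‖z‖ ≤ ‖w‖ → F w ≤ F z)
    {ξ : EuclideanSpace ℝ (Fin 3) → EuclideanSpace ℝ (Fin 3)}
    (hξ : ξ = fun x => ∫ s in Ico 0 L, F (x - γ s) • deriv γ s)
    {t ρ : ℝ} (ht : ‖deriv γ t‖ = 1) (hρ : ρ ∈ securityRadii L γ t) :
    2 * Real.log (ρ / ε) - 1 / 2 - 2 * Real.sqrt (96 * K * L / ρ) ≤ ⟪ξ (γ t), deriv γ t⟫ := by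
  have hL := hγ.pos
  have hK0 : (0:ℝ) ≤ K := K.2
  have hρ0 : 0 < ρ := hρ.1
  have hρL : ρ ≤ L / 2 := hγ.le_half_of_mem_securityRadii ht hρ
  rw [inner_testField_eq hγ hFc hFs hξ t]
  set φ : ℝ → ℝ := fun d => if ε ≤ d ∧ d ≤ ρ then d⁻¹ - d / (2 * ρ ^ 2) else 0 with hφ
  set G : ℝ → ℝ := fun s => (max (ρ / 2) ‖γ s - γ t‖)⁻¹ with hG
  have hae := selfEnergy_integrand_ge hγ hε hF0 hFle hFann hFanti ht hρ
  -- integrability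
  have hφ_meas : Measurable φ := by
    simp only [hφ]
    refine Measurable.ite ?_ (measurable_inv.sub (measurable_id.div_const _)) measurable_const
    exact (measurableSet_le measurable_const measurable_id).inter
      (measurableSet_le measurable_id measurable_const)
  have hφ_bdd : ∀ d, |φ d| ≤ ε⁻¹ + ρ / (2 * ρ ^ 2) := by
    intro d
    simp only [hφ]
    split_ifs with hh
    · obtain ⟨h1, h2⟩ := hh
      have hpos : 0 < d := hε.trans_le h1
      refine (abs_sub _ _).trans (add_le_add ?_ ?_)
      · rw [abs_of_pos (inv_pos.2 hpos)]; exact inv_anti₀ hε h1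
      · rw [abs_of_nonneg (by positivity)]; gcongr
    · rw [abs_zero]; positivity
  have hld_meas : Measurable fun s => loopDist L (s - t) := by
    unfold loopDist
    exact (continuous_norm.comp ((AddCircle.continuous_mk' L).comp
      (continuous_id.sub continuous_const))).measurable
  have i1 : Integrable (fun s => φ (loopDist L (s - t))) (volume.restrict (Ico 0 L)) := by
    refine Integrable.of_bound ((hφ_meas.comp hld_meas).aestronglyMeasurable) (ε⁻¹ + ρ / (2 * ρ ^ 2))
      (ae_of_all _ fun s => ?_)
    rw [Real.norm_eq_abs]; exact hφ_bdd _
  have hG_meas : Measurable G :=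
    ((continuous_const.max (hγ.lipschitz.continuous.sub continuous_const).norm).inv₀
      (fun s => (lt_max_of_lt_left (by positivity : (0:ℝ) < ρ / 2)).ne')).measurable
  have i2 : Integrable G (volume.restrict (Ico 0 L)) := by
    refine Integrable.of_bound hG_meas.aestronglyMeasurable ((ρ / 2)⁻¹) (ae_of_all _ fun s => ?_)
    rw [Real.norm_eq_abs, abs_of_nonneg (inv_nonneg.2 (le_max_of_le_left (by positivity)))]
    exact inv_anti₀ (by positivity) (le_max_left _ _)
  have i3 : Integrable (fun s => F (γ t - γ s) * ⟪deriv γ s, deriv γ t⟫)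
      (volume.restrict (Ico 0 L)) := by
    obtain ⟨C, hC0, hC⟩ := exists_bound_of_continuous_hasCompactSupport hFc hFs
    have hm : AEStronglyMeasurable (fun s => F (γ t - γ s) * ⟪deriv γ s, deriv γ t⟫)
        (volume.restrict (Ico 0 L)) :=
      ((hFc.comp (continuous_const.sub hγ.lipschitz.continuous)).measurable.mul
        ((_root_.measurable_deriv γ).inner measurable_const)).aestronglyMeasurable
    refine Integrable.of_bound hm C (ae_of_all _ fun s => ?_)
    rw [norm_mul, Real.norm_eq_abs, Real.norm_eq_abs]
    calc |F (γ t - γ s)| * |⟪deriv γ s, deriv γ t⟫| ≤ C * 1 := by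
          refine mul_le_mul ?_ ?_ (abs_nonneg _) hC0
          · simpa [Real.norm_eq_abs] using hC (γ t - γ s)
          · calc |⟪deriv γ s, deriv γ t⟫| ≤ ‖deriv γ s‖ * ‖deriv γ t‖ := abs_real_inner_le_norm _ _
              _ ≤ 1 * 1 := mul_le_mul (hγ.norm_deriv_le_one s) (hγ.norm_deriv_le_one t)
                  (norm_nonneg _) zero_le_one
              _ = 1 := mul_one _
      _ = C := mul_one _
  -- integrate the pointwise bound
  have hmono : ∫ s in Ico 0 L, (φ (loopDist L (s - t)) - Real.sqrt 2 * G s) ≤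
      ∫ s in Ico 0 L, F (γ t - γ s) * ⟪deriv γ s, deriv γ t⟫ :=
    integral_mono_ae (i1.sub (i2.const_mul _)) i3 (ae_restrict_of_ae hae)
  rw [integral_sub i1 (i2.const_mul _), MeasureTheory.integral_const_mul,
    integral_comp_loopDist_eq hL φ t] at hmono
  have hnear := integral_nearProfile_ge (L := L) hε hρ0 hρL
  have hfar := hγ.integral_inv_dist_le hK hρ0 (γ t)
  have h96 : Real.sqrt 2 * (2 * Real.sqrt (48 * K * L / ρ)) = 2 * Real.sqrt (96 * K * L / ρ) := by
    rw [show (96 : ℝ) * K * L / ρ = 2 * (48 * K * L / ρ) by ring, Real.sqrt_mul (by norm_num)]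
    ring
  have : Real.sqrt 2 * ∫ s in Ico 0 L, G s ≤ 2 * Real.sqrt (96 * K * L / ρ) := by
    rw [← h96]; exact mul_le_mul_of_nonneg_left hfar (Real.sqrt_nonneg _)
  linarith

/-- **Lower bound for the line integral of the test field (self-energy of the filament).**
`∫ ξ · dμ_Γ ≥ 2 L log(L/ε) − 49 K L`: by `inner_testField_ge`, at a.e. parameter `t` every
admissible radius `ρ` gives `⟪ξ(γ t), γ'(t)⟫ ≥ α − 24√K √(L/ρ)` with `α = 2 log(L/ε) − ½`
(using `log y ≤ 2√y`), so `{t : ⟪ξ(γ t), γ'(t)⟫ < α − λ} ⊆ {κ* ≥ λ²/(576 K L)}` has measure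
`≤ 576 K² L/λ²` by the weak-`L¹` hypothesis (the security radius need not be measurable, so the
comparison is made on level sets), and the layer-cake bound with a `min(L, c/λ²)` tail gives
`∫ (α − ⟪ξ(γ t), γ'(t)⟫)⁺ dt ≤ 48 K L`. This is the analogue of
[JerrardSeis2016, Prop. 1 (ve.2): `‖v^ε‖² = |log ε|/(2π) + O(‖κ*‖²)`]. [cite: JerrardSeis2016, Prop 1 (ve.2) (analogue)] -/
theorem tangentLineIntegral_ge (hγ : IsArclengthLoop L γ) {K : ℝ≥0}
    (hK : weakL1Norm L (kappaStar L γ) ≤ K) {ε : ℝ} (hε : 0 < ε)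
    {F : EuclideanSpace ℝ (Fin 3) → ℝ} (hFc : Continuous F) (hFs : HasCompactSupport F)
    (hF0 : ∀ z, 0 ≤ F z)
    (hFle : ∀ z : EuclideanSpace ℝ (Fin 3), F z ≤ Real.sqrt 2 * (max ε ‖z‖)⁻¹)
    (hFann : ∀ z : EuclideanSpace ℝ (Fin 3), ε ≤ ‖z‖ → ‖z‖ ≤ L / 2 → F z = ‖z‖⁻¹)
    (hFanti : ∀ z w : EuclideanSpace ℝ (Fin 3), ‖z‖ ≤ ‖w‖ → F w ≤ F z)
    {ξ : EuclideanSpace ℝ (Fin 3) → EuclideanSpace ℝ (Fin 3)}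
    (hξ : ξ = fun x => ∫ s in Ico 0 L, F (x - γ s) • deriv γ s) (hξc : Continuous ξ)
    (hξs : HasCompactSupport ξ) :
    2 * L * Real.log (L / ε) - 49 * K * L ≤ tangentLineIntegral L γ ξ := by
  have hL := hγ.pos
  have hK2 : (2:ℝ) ≤ K := hγ.two_le_of_weakL1Norm_le hK
  have hK0 : (0:ℝ) < K := by linarith
  have hK1 : (1:ℝ) ≤ Real.sqrt K := by
    rw [show (1:ℝ) = Real.sqrt 1 by simp]; exact Real.sqrt_le_sqrt (by linarith)
  obtain ⟨Cξ, hCξ0, hCξ⟩ := exists_bound_of_continuous_hasCompactSupport hξc hξs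
  set inner : ℝ → ℝ := fun t => ⟪ξ (γ t), deriv γ t⟫ with hinner
  have hinner_meas : Measurable inner :=
    (hξc.comp hγ.lipschitz.continuous).measurable.inner (_root_.measurable_deriv γ)
  have hinner_bdd : ∀ t, |inner t| ≤ Cξ := by
    intro t
    calc |⟪ξ (γ t), deriv γ t⟫| ≤ ‖ξ (γ t)‖ * ‖deriv γ t‖ := abs_real_inner_le_norm _ _
      _ ≤ Cξ * 1 := mul_le_mul (hCξ _) (hγ.norm_deriv_le_one t) (norm_nonneg _) hCξ0
      _ = Cξ := mul_one _
  set α : ℝ := 2 * Real.log (L / ε) - 1 / 2 with hα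
  -- Step 1: at good parameters, every admissible radius bounds `inner` from below
  have hstep1 : ∀ t ρ, ‖deriv γ t‖ = 1 → ρ ∈ securityRadii L γ t →
      α - 24 * Real.sqrt K * Real.sqrt (L / ρ) ≤ inner t := by
    intro t ρ ht hρ
    have hρ0 : 0 < ρ := hρ.1
    have h1 := inner_testField_ge hγ hK hε hFc hFs hF0 hFle hFann hFanti hξ ht hρ
    have hy : 0 < L / ρ := by positivity
    have h2 : 2 * Real.log (L / ρ) ≤ 4 * Real.sqrt K * Real.sqrt (L / ρ) := by
      have : Real.log (L / ρ) ≤ 2 * Real.sqrt (L / ρ) := by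
        have h1 := Real.log_le_sub_one_of_pos (Real.sqrt_pos.2 hy)
        have h2 : Real.log (L / ρ) = 2 * Real.log (Real.sqrt (L / ρ)) := by
          rw [Real.log_sqrt hy.le]; ring
        rw [h2]; linarith
      nlinarith [Real.sqrt_nonneg (L / ρ)]
    have h3 : 2 * Real.sqrt (96 * K * L / ρ) ≤ 20 * Real.sqrt K * Real.sqrt (L / ρ) := by
      rw [show (96 : ℝ) * K * L / ρ = 96 * (K * (L / ρ)) by ring, Real.sqrt_mul (by norm_num),
        Real.sqrt_mul hK0.le]
      have h96 : Real.sqrt 96 ≤ 10 := by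
        rw [show (10:ℝ) = Real.sqrt 100 by rw [show (100:ℝ) = 10 ^ 2 by norm_num, Real.sqrt_sq (by norm_num)]]
        exact Real.sqrt_le_sqrt (by norm_num)
      nlinarith [Real.sqrt_nonneg K, Real.sqrt_nonneg (L / ρ), Real.sqrt_nonneg 96,
        mul_nonneg (Real.sqrt_nonneg K) (Real.sqrt_nonneg (L / ρ))]
    have h4 : Real.log (ρ / ε) = Real.log (L / ε) - Real.log (L / ρ) := by
      rw [← Real.log_div (by positivity) (by positivity)]
      congr 1; field_simp
    rw [h4] at h1
    rw [hα]
    linarith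
  -- Step 2: level sets of `inner` are controlled by level sets of `κ*`
  have hlevel : ∀ lam : ℝ, 0 < lam →
      volume {t : ℝ | t ∈ Ico 0 L ∧ inner t < α - lam} ≤
        ENNReal.ofReal (576 * K ^ 2 * L / lam ^ 2) := by
    intro lam hlam
    set σ : ℝ := lam ^ 2 / (576 * K * L) with hσ
    have hσ0 : 0 < σ := by positivity
    have hbad : volume {t : ℝ | ¬ (DifferentiableAt ℝ γ t ∧ ‖deriv γ t‖ = 1)} = 0 := by
      have := hγ.ae_good; rw [ae_iff] at this; exact this
    calc volume {t : ℝ | t ∈ Ico 0 L ∧ inner t < α - lam}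
        ≤ volume ({t : ℝ | t ∈ Ico 0 L ∧ ENNReal.ofReal σ ≤ kappaStar L γ t} ∪
            {t : ℝ | ¬ (DifferentiableAt ℝ γ t ∧ ‖deriv γ t‖ = 1)}) := by
          refine measure_mono fun t ht => ?_
          by_cases hgood : DifferentiableAt ℝ γ t ∧ ‖deriv γ t‖ = 1
          · left
            refine ⟨ht.1, ?_⟩
            -- every admissible radius is `< 1/σ`
            have hrad : ∀ ρ ∈ securityRadii L γ t, ρ ≤ 1 / σ := by
              intro ρ hρ
              have hρ0 : 0 < ρ := hρ.1
              have h1 := hstep1 t ρ hgood.2 hρ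
              have h2 : lam < 24 * Real.sqrt K * Real.sqrt (L / ρ) := by linarith [ht.2]
              have h3 : lam ^ 2 < (24 * Real.sqrt K * Real.sqrt (L / ρ)) ^ 2 :=
                pow_lt_pow_left₀ h2 hlam.le two_ne_zero
              rw [mul_pow, mul_pow, Real.sq_sqrt hK0.le, Real.sq_sqrt (by positivity)] at h3
              rw [hσ, one_div, inv_div, le_div_iff₀ (by positivity)]
              have h4 : lam ^ 2 * ρ < 24 ^ 2 * K * L := by
                have := mul_lt_mul_of_pos_right h3 hρ0
                rwa [mul_assoc, div_mul_cancel₀ L hρ0.ne'] at this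
              nlinarith
            have hsec : securityRadius L γ t ≤ ENNReal.ofReal (1 / σ) := by
              rw [securityRadius, if_pos hgood.1]
              exact iSup₂_le fun ρ hρ => ENNReal.ofReal_le_ofReal (hrad ρ hρ)
            rw [kappaStar, show ENNReal.ofReal σ = (ENNReal.ofReal (1 / σ))⁻¹ by
              rw [one_div, ENNReal.ofReal_inv_of_pos hσ0, inv_inv]]
            exact ENNReal.inv_le_inv.2 hsec
          · right; exact hgood
      _ ≤ volume {t : ℝ | t ∈ Ico 0 L ∧ ENNReal.ofReal σ ≤ kappaStar L γ t} +
            volume {t : ℝ | ¬ (DifferentiableAt ℝ γ t ∧ ‖deriv γ t‖ = 1)} := measure_union_le _ _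
      _ ≤ ENNReal.ofReal (K / σ) + 0 := by rw [hbad]; exact add_le_add (volume_level_le hK hσ0) le_rfl
      _ = ENNReal.ofReal (576 * K ^ 2 * L / lam ^ 2) := by
          rw [add_zero, hσ]; congr 1; field_simp
  -- Step 3: layer cake for `G = (α − inner)⁺`
  set G : ℝ → ℝ := fun t => max (α - inner t) 0 with hG
  have hG0 : ∀ t, 0 ≤ G t := fun t => le_max_right _ _
  have hGT : ∀ t, G t ≤ |α| + Cξ + 1 := by
    intro t
    refine max_le ?_ (by positivity)
    have := hinner_bdd t
    linarith [le_abs_self α, neg_abs_le (inner t)]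
  have hGm : Measurable G := (measurable_const.sub hinner_meas).max measurable_const
  have hGint : ∫ t in Ico 0 L, G t ≤ 2 * Real.sqrt (576 * K ^ 2 * L * L) := by
    refine integral_le_of_meas_lt_le_min_sq (μ := volume.restrict (Ico (0:ℝ) L))
      (c := 576 * K ^ 2 * L) (M := L) (T := |α| + Cξ + 1) (by positivity) hL hG0 hGT
      hGm.aemeasurable fun lam hlam _ => ?_
    rw [Measure.restrict_apply' measurableSet_Ico]
    have hset : {t | lam < G t} ∩ Ico 0 L = {t : ℝ | t ∈ Ico 0 L ∧ inner t < α - lam} := by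
      ext t
      simp only [mem_inter_iff, mem_setOf_eq, hG, lt_max_iff, not_lt.2 hlam.le, or_false]
      constructor
      · rintro ⟨h1, h2⟩; exact ⟨h2, by linarith⟩
      · rintro ⟨h1, h2⟩; exact ⟨by linarith, h1⟩
    rw [hset]
    have hb2 : volume {t : ℝ | t ∈ Ico 0 L ∧ inner t < α - lam} ≤ ENNReal.ofReal L := by
      calc volume {t : ℝ | t ∈ Ico 0 L ∧ inner t < α - lam} ≤ volume (Ico (0:ℝ) L) :=
            measure_mono fun t ht => ht.1
        _ = ENNReal.ofReal L := by rw [Real.volume_Ico, sub_zero]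
    rcases le_total L (576 * K ^ 2 * L / lam ^ 2) with h | h
    · rw [min_eq_left h]; exact hb2
    · rw [min_eq_right h]; exact hlevel lam hlam
  have hsqrt : Real.sqrt (576 * K ^ 2 * L * L) = 24 * K * L := by
    rw [show (576 : ℝ) * K ^ 2 * L * L = (24 * K * L) ^ 2 by ring, Real.sqrt_sq (by positivity)]
  rw [hsqrt] at hGint
  -- Step 4: integrate `inner ≥ α − G`
  have iinner : Integrable inner (volume.restrict (Ico 0 L)) :=
    Integrable.of_bound hinner_meas.aestronglyMeasurable Cξ
      (ae_of_all _ fun t => by rw [Real.norm_eq_abs]; exact hinner_bdd t)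
  have iG : Integrable G (volume.restrict (Ico 0 L)) :=
    Integrable.of_bound hGm.aestronglyMeasurable (|α| + Cξ + 1)
      (ae_of_all _ fun t => by rw [Real.norm_eq_abs, abs_of_nonneg (hG0 t)]; exact hGT t)
  have hmono : ∫ t in Ico 0 L, (α - G t) ≤ ∫ t in Ico 0 L, inner t := by
    refine integral_mono ((integrable_const α).sub iG) iinner fun t => ?_
    show α - G t ≤ inner t
    have : α - inner t ≤ G t := le_max_left _ _
    linarith
  rw [integral_sub (integrable_const α) iG, setIntegral_const, measureReal_def, Real.volume_Ico,
    sub_zero, ENNReal.toReal_ofReal hL.le, smul_eq_mul] at hmono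
  have hT : tangentLineIntegral L γ ξ = ∫ t in Ico 0 L, inner t := rfl
  rw [hT, hα] at *
  have hKL : L ≤ K * L := by nlinarith
  nlinarith [hmono, hGint]

end SelfEnergy

end VortexFilament

end Literature.Analysis.FluidPDE
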